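import Literature.Computability.Complexity.StackMul
import Literature.Computability.Complexity.StackDiv
import Literature.Computability.Complexity.StackUnaryBits
import Literature.Computability.Complexity.StackUnary
import Literature.Computability.Complexity.StackStrings
import Literature.Computability.Complexity.UnaryLeBinary
import Literature.Computability.Complexity.TM2PassThrough
import HarnessLib

/-!
# Word arithmetic on stack programs: the unit-cost operations of the word RAM modulo `2^W`

Trunk `CplxCore`, toolkit continuing the verified stack-program libraries `StackArith.lean`
(`add`, `sub`, `normalize` on the bank `AReg`), `StackMul.lean` (`mulOf`), `StackDiv.lean` /
`StackGcd.lean` (`divOf`, `remOf`), `StackUnary.lean` (`addReg`, `dblReg`, `takeN`, `subFrom`),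
`StackUnaryBits.lean` (`toBin`) and `StackStrings.lean` (`eqCheck`). It provides, as structured
stack programs (`Com`) with proved specifications and step bounds (`Com.Runs`), the twelve
unit-cost operations of the word RAM of `Literature/Computability/Cryptography/WordRAM.lean`
(`BinOp.eval w`: `+ − ×` and `or xor shl` reduced modulo `2^w`, `÷ mod and shr`, the comparisons
`lt eq` answering `1`/`0`) on binary numerals (least significant bit first, canonical form
`encodeNat`), the word size `W` being given in unary as a *ruler* register `1^W` — the
arithmetic unit of an interpreter of word-RAM programs on Mathlib's multi-stack Turing machines
(`StackMachinesTM2.lean`), by which word-RAM upper bounds are transported to `Turing.FinTM2`.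

Programs live on `κ ⊕ AReg` (`bk`, `Com.map Sum.inr` frames the bank routines); the outer
registers used are bundled in `WRegs κ` (ruler `w`, counters `c`, `c2`, the most-significant-
bit-first operand register `m` of the long operations, the quotient register `q`, a scratch
`p`), and `WRegs.Clean` says that the ruler holds `1^W` and the others are empty. Every
operation takes its operands in `x`, `y` (bank otherwise empty), leaves the canonical numeral of
the result in `x`, empties `y`, and restores everything else:

* truncation `truncX` / `truncNorm` (`x := encodeNat (x mod 2^W)`: take the low `W` bits under a
  copy of the ruler, normalise; `bitsToNat_take`, `norm_take`);
* `addW`, `mulW` (Horner multiplication `mulOf`), `subW` (the word RAM's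
  `(x + 2^W − y mod 2^W) mod 2^W`: reduce both operands, subtract from the numeral `2^W` built by
  `pow2X`, add, reduce; `subW_arith`), `divW` / `modW` (zero test on the canonical divisor, then
  long division `divPos` / `modPos`; `x / 0 = 0`, `x mod 0 = x` as in `ℕ`);
* the bitwise operations through one zip loop `zipC f` with model `zipBits` and its reading
  `testBit_bitsToNat` / `getD_zipBits` (`bitsToNat_zipBits_and/or/xor` by `Nat.eq_of_testBit_eq`):
  `bandW`, `borW`, `bxorW`;
* comparisons `ltW` (the borrow of `sub`) and `eqW` (string equality of canonical numerals,
  `encodeNat_inj_iff`);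
* shifts `shlW` (`(x <<< y) mod 2^W`: prepend `min y W` zeros, truncate; `shlW_arith`) and `shrW`
  (`x >>> y`: drop `min y |x|` low bits; `shrW_arith`), the shift amount being capped and
  converted to unary by `capUnary` (bound to binary by `toBin`, comparison by `sub`, conversion
  of the smaller amount by the Horner loop `hornerLoop` over its bits, most significant first;
  `UnLeBin.msbVal_reverse`).

All step bounds are linear or quadratic in `W + |x| + |y|` with explicit constants. Nothing
here is specific to one program; the dispatcher on `BinOp` is in the interpreter file.

## References

* D. E. Knuth, *The Art of Computer Programming*, Vol. 2, 3rd ed., Addison-Wesley 1998, §4.3.1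
  (multiple-precision addition, subtraction, multiplication, division: Algorithms A, S, M, D).
  (Not held; the schoolbook algorithms, proved in the imported files and composed here.)
* T. Hagerup, *Sorting and searching on the word RAM*, STACS 1998, §2 (the unit-cost operations
  on `w`-bit words).
* T. Nipkow, G. Klein, *Concrete Semantics with Isabelle/HOL*, Springer 2014, Ch. 7 (big-step
  reasoning; composition of specifications).
-/

namespace Literature.Computability.Complexity

open _root_.Computability AReg

namespace Com

/-! ### Numerals: taking the low `W` bits -/

/-- The low `n` bits of a numeral carry its value modulo `2^n` (twin of `Brick.bitsToNat_take` of the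
bricks layer above this file, not importable here). [folklore] -/
theorem bitsToNat_take (xs : List Bool) (n : ℕ) : bitsToNat (xs.take n) = bitsToNat xs % 2 ^ n := by
  have h := bitsToNat_take_add_drop xs n
  have hlt : bitsToNat (xs.take n) < 2 ^ n :=
    lt_of_lt_of_le (bitsToNat_lt _) (Nat.pow_le_pow_right Nat.two_pos (List.length_take_le n xs))
  rw [← h, Nat.add_mul_mod_self_left, Nat.mod_eq_of_lt hlt]

/-- Hence the normal form of the low `W` bits is the numeral of the residue. [folklore] -/
theorem norm_take (xs : List Bool) (W : ℕ) : norm (xs.take W) = encodeNat (bitsToNat xs % 2 ^ W) := by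
  rw [norm_eq_encodeNat, bitsToNat_take]

/-! ### Bitwise operations -/

/-- `testBit` of a numeral reads the list (twins in `DefinableVNPWitness.lean`, `ShorOrdPost.lean`, not
importable here). [folklore] -/
theorem testBit_bitsToNat : ∀ (l : List Bool) (i : ℕ), (bitsToNat l).testBit i = l.getD i false
  | [], i => by simp
  | b :: l, 0 => by
    rw [bitsToNat_cons, show b.toNat + 2 * bitsToNat l = Nat.bit b (bitsToNat l) by
      rw [Nat.bit_val]; ring]
    simp
  | b :: l, i + 1 => by
    rw [bitsToNat_cons, show b.toNat + 2 * bitsToNat l = Nat.bit b (bitsToNat l) by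
      rw [Nat.bit_val]; ring, Nat.testBit_bit_succ, testBit_bitsToNat l i]
    simp

/-- Model of the bitwise zip of two numerals (the shorter padded with zeros). [folklore] -/
def zipBits (f : Bool → Bool → Bool) : List Bool → List Bool → List Bool
  | [], ys => ys.map (f false)
  | a :: xs, [] => f a false :: zipBits f xs []
  | a :: xs, b :: ys => f a b :: zipBits f xs ys

/-- The zip, read bit by bit (for `f` vanishing on zeros). [folklore] -/
theorem getD_zipBits {f : Bool → Bool → Bool} (hf : f false false = false) :
    ∀ (xs ys : List Bool) (i : ℕ),
      (zipBits f xs ys).getD i false = f (xs.getD i false) (ys.getD i false)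
  | [], ys, i => by
    simp only [zipBits, List.getD_nil]
    rw [List.getD_eq_getElem?_getD, List.getElem?_map, List.getD_eq_getElem?_getD]
    cases ys[i]? <;> simp [hf]
  | a :: xs, [], 0 => by simp [zipBits]
  | a :: xs, [], i + 1 => by
    simp only [zipBits, List.getD_cons_succ, List.getD_nil]
    rw [getD_zipBits hf xs [] i]; simp
  | a :: xs, b :: ys, 0 => by simp [zipBits]
  | a :: xs, b :: ys, i + 1 => by
    simp only [zipBits, List.getD_cons_succ]
    exact getD_zipBits hf xs ys i

/-- **The zip with `and` is the bitwise and.** [folklore] -/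
theorem bitsToNat_zipBits_and (xs ys : List Bool) :
    bitsToNat (zipBits (· && ·) xs ys) = bitsToNat xs &&& bitsToNat ys := by
  refine Nat.eq_of_testBit_eq fun i => ?_
  rw [testBit_bitsToNat, getD_zipBits (by rfl), Nat.testBit_and, testBit_bitsToNat, testBit_bitsToNat]

/-- **The zip with `or` is the bitwise or.** [folklore] -/
theorem bitsToNat_zipBits_or (xs ys : List Bool) :
    bitsToNat (zipBits (· || ·) xs ys) = bitsToNat xs ||| bitsToNat ys := by
  refine Nat.eq_of_testBit_eq fun i => ?_
  rw [testBit_bitsToNat, getD_zipBits (by rfl), Nat.testBit_or, testBit_bitsToNat, testBit_bitsToNat]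

/-- **The zip with `xor` is the bitwise xor.** [folklore] -/
theorem bitsToNat_zipBits_xor (xs ys : List Bool) :
    bitsToNat (zipBits Bool.xor xs ys) = bitsToNat xs ^^^ bitsToNat ys := by
  refine Nat.eq_of_testBit_eq fun i => ?_
  rw [testBit_bitsToNat, getD_zipBits (by rfl), Nat.testBit_xor, testBit_bitsToNat, testBit_bitsToNat]

/-- Length of the zip. [folklore] -/
theorem length_zipBits (f : Bool → Bool → Bool) : ∀ (xs ys : List Bool),
    (zipBits f xs ys).length = max xs.length ys.length
  | [], ys => by simp [zipBits]
  | a :: xs, [] => by simp [zipBits, length_zipBits f xs []]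
  | a :: xs, b :: ys => by simp [zipBits, length_zipBits f xs ys, Nat.succ_max_succ]

section Zip

variable (f : Bool → Bool → Bool)

/-- A leaf of the zip loop: emit `f a b` on `s`. [folklore] -/
def zipLeaf (a b : Bool) : Com AReg := push .s (f a b)

/-- Body of the first zip loop, for the bit `a` popped from `x`: pop the matching bit of `y`
(a missing bit counts as `0`). [folklore] -/
def zipBody (a : Bool) : Com AReg := pop .y (zipLeaf f a true) (zipLeaf f a false) (zipLeaf f a false)

/-- First zip loop: over the bits of `x`. [folklore] -/
def zipLoop1 : Com AReg := loop .x (zipBody f true) (zipBody f false)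

/-- Second zip loop: the remaining bits of `y` against zeros. [folklore] -/
def zipLoop2 : Com AReg := loop .y (push .s (f false true)) (push .s (f false false))

/-- `zipC f`: `x := norm (zipBits f x y)`, `y` emptied (results accumulate reversed on `s` and
are poured back). [folklore] -/
def zipC : Com AReg := zipLoop1 f ;; zipLoop2 f ;; pour .s .x ;; normalize

/-- Model of the first loop: (emitted bits reversed onto `sa`, rest of `y`). [folklore] -/
def zpL1 : List Bool → List Bool → List Bool → List Bool × List Bool
  | [], ys, sa => (sa, ys)
  | a :: xs, [], sa => zpL1 xs [] (f a false :: sa)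
  | a :: xs, b :: ys, sa => zpL1 xs ys (f a b :: sa)

/-- The first loop against the model of the zip. [folklore] -/
theorem zpL1_eq : ∀ (xs ys sa : List Bool),
    zpL1 f xs ys sa = ((zipBits f xs (ys.take xs.length)).reverse ++ sa, ys.drop xs.length)
  | [], ys, sa => by simp [zpL1, zipBits]
  | a :: xs, [], sa => by
    rw [zpL1, zpL1_eq xs [] _]; simp [zipBits]
  | a :: xs, b :: ys, sa => by
    rw [zpL1, zpL1_eq xs ys _]; simp [zipBits]

/-- Simulation of the first zip loop. [folklore] -/
theorem runs_zipLoop1 : ∀ (xs ys sa z0 t0 u0 fr g0 : List Bool),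
    Runs (zipLoop1 f) (file xs ys z0 sa t0 u0 fr g0)
      (file [] (zpL1 f xs ys sa).2 z0 (zpL1 f xs ys sa).1 t0 u0 fr g0) (5 * xs.length + 1)
  | [], ys, sa, z0, t0, u0, fr, g0 => (Runs.loop_nil _ _ rfl).of_eq (by simp [zpL1]) (by simp)
  | a :: xs, ys, sa, z0, t0, u0, fr, g0 => by
    have hk : file (a :: xs) ys z0 sa t0 u0 fr g0 .x = a :: xs := rfl
    rcases ys with _ | ⟨b, ys⟩
    · have hbody : ∀ a' : Bool, Runs (zipBody f a') (file xs [] z0 sa t0 u0 fr g0)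
          (file xs [] z0 (f a' false :: sa) t0 u0 fr g0) 3 := fun a' =>
        Runs.pop_nil _ _ rfl (Runs.push' (by simp))
      have ih := runs_zipLoop1 xs [] (f a false :: sa) z0 t0 u0 fr g0
      rw [show zpL1 f (a :: xs) [] sa = zpL1 f xs [] (f a false :: sa) from rfl]
      cases a
      · exact (Runs.loop_false hk (by simpa using hbody false) ih).of_eq rfl (by simp; omega)
      · exact (Runs.loop_true hk (by simpa using hbody true) ih).of_eq rfl (by simp; omega)
    · have hbody : ∀ a' : Bool, Runs (zipBody f a') (file xs (b :: ys) z0 sa t0 u0 fr g0)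
          (file xs ys z0 (f a' b :: sa) t0 u0 fr g0) 3 := fun a' => by
        cases b
        · exact Runs.pop_false _ _ rfl (Runs.push' (by simp))
        · exact Runs.pop_true _ _ rfl (Runs.push' (by simp))
      have ih := runs_zipLoop1 xs ys (f a b :: sa) z0 t0 u0 fr g0
      rw [show zpL1 f (a :: xs) (b :: ys) sa = zpL1 f xs ys (f a b :: sa) from rfl]
      cases a
      · exact (Runs.loop_false hk (by simpa using hbody false) ih).of_eq rfl (by simp; omega)
      · exact (Runs.loop_true hk (by simpa using hbody true) ih).of_eq rfl (by simp; omega)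

/-- Simulation of the second zip loop. [folklore] -/
theorem runs_zipLoop2 : ∀ (ys sa z0 t0 u0 fr g0 : List Bool),
    Runs (zipLoop2 f) (file [] ys z0 sa t0 u0 fr g0)
      (file [] [] z0 ((ys.map (f false)).reverse ++ sa) t0 u0 fr g0) (3 * ys.length + 1)
  | [], sa, z0, t0, u0, fr, g0 => (Runs.loop_nil _ _ rfl).of_eq (by simp) (by simp)
  | b :: ys, sa, z0, t0, u0, fr, g0 => by
    have hk : file [] (b :: ys) z0 sa t0 u0 fr g0 .y = b :: ys := rfl
    have hbody : ∀ b' : Bool, Runs (push AReg.s (f false b')) (file [] ys z0 sa t0 u0 fr g0)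
        (file [] ys z0 (f false b' :: sa) t0 u0 fr g0) 1 := fun b' => Runs.push' (by simp)
    have ih := fun b' : Bool => runs_zipLoop2 ys (f false b' :: sa) z0 t0 u0 fr g0
    have e : ∀ b' : Bool, (ys.map (f false)).reverse ++ f false b' :: sa =
        ((b' :: ys).map (f false)).reverse ++ sa := fun b' => by simp
    cases b
    · exact (Runs.loop_false hk (by simpa using hbody false) ((ih false).of_eq (by rw [e]) le_rfl)).of_eq
        rfl (by simp; omega)
    · exact (Runs.loop_true hk (by simpa using hbody true) ((ih true).of_eq (by rw [e]) le_rfl)).of_eq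
        rfl (by simp; omega)

/-- The two loops together emit the whole zip, reversed. [folklore] -/
theorem zip_loops_eq (xs ys : List Bool) :
    ((ys.drop xs.length).map (f false)).reverse ++ (zipBits f xs (ys.take xs.length)).reverse =
      (zipBits f xs ys).reverse := by
  rw [← List.reverse_append]
  congr 1
  induction xs generalizing ys with
  | nil => simp [zipBits]
  | cons a xs ih =>
    rcases ys with _ | ⟨b, ys⟩
    · simp
    · simp only [List.length_cons, List.take_succ_cons, List.drop_succ_cons, zipBits, List.cons_append,
        ih ys]

/-- **Simulation of `zipC`**: `x := norm (zipBits f x y)`, `y` emptied, in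
`≤ 17 (|x| + |y|) + 8` steps (flag `f` and scratch `s` empty). [folklore] -/
theorem runs_zipC (xs ys z t u g : List Bool) :
    Runs (zipC f) (file xs ys z [] t u [] g) (file (norm (zipBits f xs ys)) [] z [] t u [] g)
      (17 * (xs.length + ys.length) + 8) := by
  have h1 := runs_zipLoop1 f xs ys [] z t u [] g
  rw [zpL1_eq] at h1
  simp only [List.append_nil] at h1
  have h2 := runs_zipLoop2 f (ys.drop xs.length) (zipBits f xs (ys.take xs.length)).reverse z t u [] g
  rw [zip_loops_eq] at h2
  have h3 := runs_pour (a := AReg.s) (b := AReg.x) (by decide) (file [] [] z (zipBits f xs ys).reverse t u [] g)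
  simp only [file_s, file_x, List.reverse_reverse, List.append_nil, update_file_s, update_file_x] at h3
  have h4 := runs_normalize (zipBits f xs ys) [] z t u g
  refine (h1.seq (h2.seq (h3.seq h4))).of_eq rfl ?_
  have l1 : (ys.drop xs.length).length ≤ ys.length := by simp
  have l2 := length_zipBits f xs ys
  have l3 : max xs.length ys.length ≤ xs.length + ys.length := max_le (Nat.le_add_right _ _) (Nat.le_add_left _ _)
  simp only [List.length_reverse]
  omega

end Zip

section WordArith

variable {κ : Type} [DecidableEq κ]

/-- The outer registers used by the word operations, around the arithmetic bank `AReg`: the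
ruler `w` (holding `1^W`, never changed), counters `c`, `c2`, the most-significant-bit-first
operand register `m` of `mulOf`/`divOf`/`remOf`, the quotient register `q`, and a scratch `p`;
pairwise distinct. [folklore] -/
structure WRegs (κ : Type) where
  /-- the ruler `1^W` -/
  w : κ
  /-- a counter -/
  c : κ
  /-- a second counter -/
  c2 : κ
  /-- operand register of the long operations (most significant bit first) -/
  m : κ
  /-- quotient register -/
  q : κ
  /-- scratch -/
  p : κ
  w_c : w ≠ c
  w_c2 : w ≠ c2
  w_m : w ≠ m
  w_q : w ≠ q
  w_p : w ≠ p
  c_c2 : c ≠ c2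
  c_m : c ≠ m
  c_q : c ≠ q
  c_p : c ≠ p
  c2_m : c2 ≠ m
  c2_q : c2 ≠ q
  c2_p : c2 ≠ p
  m_q : m ≠ q
  m_p : m ≠ p
  q_p : q ≠ p

variable (r : WRegs κ)

/-- `Clean r T W`: the ruler holds `1^W` and the other outer registers are empty. [folklore] -/
structure WRegs.Clean (T : Regs κ) (W : ℕ) : Prop where
  hw : T r.w = ones W
  hc : T r.c = []
  hc2 : T r.c2 = []
  hm : T r.m = []
  hq : T r.q = []
  hp : T r.p = []

/-! ### Truncation to `W` bits -/

/-- `truncX`: `x := x ↾ W` (the low `W` bits), using a copy of the ruler as counter. [folklore] -/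
def truncX : Com (κ ⊕ AReg) :=
  copy (Sum.inl r.w) (Sum.inl r.c) (Sum.inr .s) (Sum.inr .t) ;;
  takeN (Sum.inl r.c) (Sum.inr .x) (Sum.inr .s) ;;
  clear (Sum.inr AReg.x) ;;
  pour (Sum.inr AReg.s) (Sum.inr AReg.x)

/-- Effect of `truncX`: `x := x ↾ W`, everything else unchanged, in `≤ 20 (W + |x|) + 6` steps.
[folklore] -/
theorem runs_truncX {T : Regs κ} {W : ℕ} (hT : r.Clean T W) (xs y z u f g : List Bool) :
    Runs (truncX r) (Sum.elim T (file xs y z [] [] u f g))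
      (Sum.elim T (file (xs.take W) y z [] [] u f g)) (20 * (W + xs.length) + 6) := by
  have h1 := runs_copy (a := (Sum.inl r.w : κ ⊕ AReg)) (b := Sum.inl r.c) (t := Sum.inr AReg.s)
    (u := Sum.inr AReg.t) (by simp [r.w_c]) (by simp) (by simp) (by simp) (by simp) (by simp)
    (Sum.elim T (file xs y z [] [] u f g)) (by simp) (by simp)
  simp only [Sum.elim_inl, hT.hw, hT.hc, List.append_nil, Sum.update_elim_inl] at h1
  have h2 := runs_takeN (q := (Sum.inl r.c : κ ⊕ AReg)) (s := Sum.inr AReg.x) (d := Sum.inr AReg.s)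
    (by simp) (by simp) (by simp) (ones W) (Sum.elim (Function.update T r.c (ones W)) (file xs y z [] [] u f g))
    (by simp)
  simp only [Sum.update_elim_inl, Function.update_idem, Sum.elim_inr, file_x, Sum.update_elim_inr,
    update_file_x, file_s, List.append_nil, update_file_s, List.length_replicate] at h2
  have h3 := runs_clear (Sum.inr AReg.x : κ ⊕ AReg)
    (Sum.elim (Function.update T r.c []) (file (xs.drop W) y z ((xs.take W).reverse) [] u f g))
  simp only [Sum.elim_inr, file_x, Sum.update_elim_inr, update_file_x] at h3
  have h4 := runs_pour (a := (Sum.inr AReg.s : κ ⊕ AReg)) (b := Sum.inr AReg.x) (by simp)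
    (Sum.elim (Function.update T r.c []) (file [] y z ((xs.take W).reverse) [] u f g))
  simp only [Sum.elim_inr, file_s, Sum.update_elim_inr, update_file_s, file_x, List.reverse_reverse,
    List.append_nil, update_file_x] at h4
  have hT' : Function.update T r.c [] = T := by
    rw [← hT.hc]; exact Function.update_eq_self _ _
  rw [hT'] at h2 h3 h4
  refine (h1.seq (h2.seq (h3.seq h4))).of_eq rfl ?_
  have e1 : (xs.drop W).length ≤ xs.length := by simp
  have e2 : ((xs.take W).reverse).length ≤ W := by simp
  have e3 : (ones W).length = W := by simp
  omega

/-- `truncNorm`: `x := encodeNat (x mod 2^W)` (take the low `W` bits, then normalise).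
[folklore] -/
def truncNorm : Com (κ ⊕ AReg) := truncX r ;; bk normalize

/-- Effect of `truncNorm`, in `≤ 29 (W + |x|) + 11` steps (the flag register `f` and the scratch
`s`, `t` must be empty). [folklore] -/
theorem runs_truncNorm {T : Regs κ} {W : ℕ} (hT : r.Clean T W) (xs y z u g : List Bool) :
    Runs (truncNorm r) (Sum.elim T (file xs y z [] [] u [] g))
      (Sum.elim T (file (encodeNat (bitsToNat xs % 2 ^ W)) y z [] [] u [] g))
      (29 * (W + xs.length) + 11) := by
  have h1 := runs_truncX r hT xs y z u [] g
  have h2 := (runs_normalize (xs.take W) y z [] u g).inr T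
  rw [norm_take] at h2
  refine (h1.seq h2).of_eq rfl ?_
  have : (xs.take W).length ≤ xs.length := List.length_take_le' _ _
  omega

/-- A numeral of a number `< 2^n` has at most `n` digits (twin of `Literature.Computability.Cryptography.length_encodeNat_le_of_lt`,
not importable here; via `TM2Pass.length_encodeNat_eq_size`). [folklore] -/
theorem length_encodeNat_le_of_lt {v n : ℕ} (h : v < 2 ^ n) : (encodeNat v).length ≤ n := by
  rw [TM2Pass.length_encodeNat_eq_size]; exact Nat.size_le.2 h

/-- A residue modulo `2^W` has at most `W` digits. [folklore] -/
theorem length_encodeNat_mod_two_pow_le (v W : ℕ) : (encodeNat (v % 2 ^ W)).length ≤ W :=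
  length_encodeNat_le_of_lt (Nat.mod_lt _ (Nat.two_pow_pos W))

/-! ### Addition and multiplication modulo `2^W` -/

/-- `addW`: `x := (x + y) mod 2^W`, `y` emptied. [folklore] -/
def addW : Com (κ ⊕ AReg) := bk add ;; clear (Sum.inr AReg.y) ;; truncNorm r

/-- Effect of `addW`. [folklore] -/
theorem runs_addW {T : Regs κ} {W : ℕ} (hT : r.Clean T W) (xs ys : List Bool) :
    Runs (addW r) (Sum.elim T (file xs ys [] [] [] [] [] []))
      (Sum.elim T (file (encodeNat ((bitsToNat xs + bitsToNat ys) % 2 ^ W)) [] [] [] [] [] [] []))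
      (44 * (W + xs.length + ys.length) + 53) := by
  have h1 := (runs_add xs ys [] [] []).inr T
  have h2 := runs_clear (Sum.inr AReg.y : κ ⊕ AReg) (Sum.elim T (file (addRes xs ys) ys [] [] [] [] [] []))
  simp only [Sum.elim_inr, file_y, Sum.update_elim_inr, update_file_y] at h2
  have h3 := runs_truncNorm r hT (addRes xs ys) [] [] [] []
  rw [bitsToNat_addRes] at h3
  refine (h1.seq (h2.seq h3)).of_eq rfl ?_
  have := length_addRes_le xs ys
  omega

/-- `mulW`: `x := (x · y) mod 2^W`, `y` emptied (Horner multiplication `mulOf` over the bits of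
`x`, most significant first, read from the outer register `m`). [folklore] -/
def mulW : Com (κ ⊕ AReg) :=
  pour (Sum.inr AReg.x) (Sum.inl r.m) ;; mulOf r.m ;; clear (Sum.inr AReg.y) ;; truncNorm r

/-- Effect of `mulW`. [folklore] -/
theorem runs_mulW {T : Regs κ} {W : ℕ} (hT : r.Clean T W) (xs ys : List Bool) :
    Runs (mulW r) (Sum.elim T (file xs ys [] [] [] [] [] []))
      (Sum.elim T (file (encodeNat ((bitsToNat xs * bitsToNat ys) % 2 ^ W)) [] [] [] [] [] [] []))
      (50 * (W + xs.length + ys.length + 1) ^ 2) := by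
  have h1 := runs_pour (a := (Sum.inr AReg.x : κ ⊕ AReg)) (b := Sum.inl r.m) (by simp)
    (Sum.elim T (file xs ys [] [] [] [] [] []))
  simp only [Sum.elim_inr, file_x, Sum.update_elim_inr, update_file_x, Sum.elim_inl, hT.hm,
    List.append_nil, Sum.update_elim_inl] at h1
  have h2 := runs_mulOf (κ := κ) r.m xs.reverse (Function.update T r.m xs.reverse) [] ys [] [] []
    ys.length (by simp) (by simpa using bitsToNat_lt ys) (by simp) le_rfl
  rw [Function.update_idem, mulOfRes_nil_eq_encodeNat, List.reverse_reverse] at h2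
  have hT' : Function.update T r.m [] = T := by
    rw [← hT.hm]; exact Function.update_eq_self _ _
  rw [hT', Nat.mul_comm] at h2
  have h3 := runs_clear (Sum.inr AReg.y : κ ⊕ AReg)
    (Sum.elim T (file (encodeNat (bitsToNat xs * bitsToNat ys)) ys [] [] [] [] [] []))
  simp only [Sum.elim_inr, file_y, Sum.update_elim_inr, update_file_y] at h3
  have h4 := runs_truncNorm r hT (encodeNat (bitsToNat xs * bitsToNat ys)) [] [] [] []
  rw [bitsToNat_encodeNat] at h4
  refine (h1.seq (h2.seq (h3.seq h4))).of_eq rfl ?_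
  have hlen : (encodeNat (bitsToNat xs * bitsToNat ys)).length ≤ xs.length + ys.length := by
    apply length_encodeNat_le_of_lt
    rw [pow_add]
    exact Nat.mul_lt_mul'' (bitsToNat_lt xs) (bitsToNat_lt ys)
  set a := xs.length
  set b := ys.length
  have e1 : (xs.reverse).length = a := by simp [a]
  rw [e1]
  have key : 3 * a + 1 + (a * (44 * (b + a) + 52) + 1) + (2 * b + 1) +
      (29 * (W + (b + a)) + 11) ≤ 50 * (W + a + b + 1) ^ 2 := by nlinarith
  refine le_trans ?_ key
  have : (encodeNat (bitsToNat xs * bitsToNat ys)).length ≤ b + a := by omega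
  nlinarith [this]

/-! ### The numeral `2^W` and subtraction modulo `2^W` -/

/-- The loop pushing one `false` on `x` per unit of the counter `c`. [folklore] -/
def fillFalseLoop : Com (κ ⊕ AReg) :=
  loop (Sum.inl r.c) (push (Sum.inr AReg.x) false) (push (Sum.inr AReg.x) false)

/-- Effect of the filling loop: `x := 0^{|c|} ++ x`, `c` emptied, cost `3|c| + 1`. [folklore] -/
theorem runs_fillFalseLoop : ∀ (cs : List Bool) (T : Regs κ) (x0 y0 z0 s0 t0 u0 f0 g0 : List Bool),
    T r.c = cs →
    Runs (fillFalseLoop r) (Sum.elim T (file x0 y0 z0 s0 t0 u0 f0 g0))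
      (Sum.elim (Function.update T r.c [])
        (file (List.replicate cs.length false ++ x0) y0 z0 s0 t0 u0 f0 g0))
      (3 * cs.length + 1)
  | [], T, x0, y0, z0, s0, t0, u0, f0, g0, hc => by
    have hT' : Function.update T r.c [] = T := by rw [← hc]; exact Function.update_eq_self _ _
    refine (Runs.loop_nil _ _ (by simp [hc])).of_eq ?_ (by simp)
    rw [hT']; simp
  | b :: cs, T, x0, y0, z0, s0, t0, u0, f0, g0, hc => by
    have hk : (Sum.elim T (file x0 y0 z0 s0 t0 u0 f0 g0) : Regs (κ ⊕ AReg)) (Sum.inl r.c) = b :: cs := by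
      simp [hc]
    have hbody : Runs (push (Sum.inr AReg.x) false : Com (κ ⊕ AReg))
        (Function.update (Sum.elim T (file x0 y0 z0 s0 t0 u0 f0 g0)) (Sum.inl r.c) cs)
        (Sum.elim (Function.update T r.c cs) (file (false :: x0) y0 z0 s0 t0 u0 f0 g0)) 1 :=
      Runs.push' (by simp only [Sum.update_elim_inl, Sum.update_elim_inr, Sum.elim_inr, file_x,
        update_file_x])
    have ih := runs_fillFalseLoop cs (Function.update T r.c cs) (false :: x0) y0 z0 s0 t0 u0 f0 g0
      (by simp)
    rw [Function.update_idem] at ih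
    have e : List.replicate cs.length false ++ false :: x0 =
        List.replicate (b :: cs).length false ++ x0 := by
      simp [List.replicate_succ']
    rw [e] at ih
    cases b
    · exact (Runs.loop_false hk hbody ih).of_eq rfl (by simp; omega)
    · exact (Runs.loop_true hk hbody ih).of_eq rfl (by simp; omega)

/-- `pow2X`: with `x` empty, `x := encodeNat (2^W) = 0^W 1` (push the leading one, then one
zero per unit of a copy of the ruler). [folklore] -/
def pow2X : Com (κ ⊕ AReg) :=
  push (Sum.inr AReg.x) true ;;
  copy (Sum.inl r.w) (Sum.inl r.c) (Sum.inr .s) (Sum.inr .t) ;;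
  fillFalseLoop r

/-- The numeral of `2^W` (twin of `TavRecode.encodeNat_two_pow`, not importable here). [folklore] -/
theorem encodeNat_two_pow (W : ℕ) : encodeNat (2 ^ W) = List.replicate W false ++ [true] := by
  refine (eq_of_bitsToNat_eq_of_canonical _ _ (encodeNat_canonical _) (Or.inr ⟨_, rfl⟩) ?_)
  rw [bitsToNat_encodeNat, bitsToNat_append]; simp

/-- Effect of `pow2X`, in `≤ 13 W + 5` steps. [folklore] -/
theorem runs_pow2X {T : Regs κ} {W : ℕ} (hT : r.Clean T W) (y z u f g : List Bool) :
    Runs (pow2X r) (Sum.elim T (file [] y z [] [] u f g))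
      (Sum.elim T (file (encodeNat (2 ^ W)) y z [] [] u f g)) (13 * W + 5) := by
  have h1 : Runs (push (Sum.inr AReg.x) true : Com (κ ⊕ AReg)) (Sum.elim T (file [] y z [] [] u f g))
      (Sum.elim T (file [true] y z [] [] u f g)) 1 := Runs.push' (by simp)
  have h2 := runs_copy (a := (Sum.inl r.w : κ ⊕ AReg)) (b := Sum.inl r.c) (t := Sum.inr AReg.s)
    (u := Sum.inr AReg.t) (by simp [r.w_c]) (by simp) (by simp) (by simp) (by simp) (by simp)
    (Sum.elim T (file [true] y z [] [] u f g)) (by simp) (by simp)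
  simp only [Sum.elim_inl, hT.hw, hT.hc, List.append_nil, Sum.update_elim_inl] at h2
  have h3 := runs_fillFalseLoop r (ones W) (Function.update T r.c (ones W)) [true] y z [] [] u f g (by simp)
  rw [Function.update_idem, List.length_replicate, ← encodeNat_two_pow] at h3
  have hT' : Function.update T r.c [] = T := by
    rw [← hT.hc]; exact Function.update_eq_self _ _
  rw [hT'] at h3
  refine (h1.seq (h2.seq h3)).of_eq rfl ?_
  simp only [List.length_replicate]; omega

/-- The arithmetic of subtraction modulo `2^W`: with `a' = a mod 2^W`, `b' = b mod 2^W`,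
`(2^W - b' + a') mod 2^W = (a + 2^W - b mod 2^W) mod 2^W`. [folklore] -/
theorem subW_arith (a b W : ℕ) :
    (2 ^ W - b % 2 ^ W + a % 2 ^ W) % 2 ^ W = (a + 2 ^ W - b % 2 ^ W) % 2 ^ W := by
  have hb : b % 2 ^ W < 2 ^ W := Nat.mod_lt _ (Nat.two_pow_pos W)
  have ha := Nat.div_add_mod a (2 ^ W)
  have e : a + 2 ^ W - b % 2 ^ W = (2 ^ W - b % 2 ^ W + a % 2 ^ W) + 2 ^ W * (a / 2 ^ W) := by
    omega
  rw [e, Nat.add_mul_mod_self_left]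

/-- `subW`: `x := (x + 2^W - y mod 2^W) mod 2^W` (the word RAM's subtraction), `y` emptied:
reduce both operands, form `2^W - y'` by one subtraction without borrow, add `x'`, reduce.
[folklore] -/
def subW : Com (κ ⊕ AReg) :=
  truncNorm r ;; bk swapXY ;; truncNorm r ;;
  bk swapYZ ;; bk swapXY ;;
  pow2X r ;; bk sub ;; clear (Sum.inr AReg.g) ;; clear (Sum.inr AReg.y) ;; bk swapYZ ;;
  bk add ;; clear (Sum.inr AReg.y) ;; truncNorm r

/-- Effect of `subW`. [folklore] -/
theorem runs_subW {T : Regs κ} {W : ℕ} (hT : r.Clean T W) (xs ys : List Bool) :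
    Runs (subW r) (Sum.elim T (file xs ys [] [] [] [] [] []))
      (Sum.elim T (file (encodeNat ((bitsToNat xs + 2 ^ W - bitsToNat ys % 2 ^ W) % 2 ^ W))
        [] [] [] [] [] [] []))
      (250 * (W + xs.length + ys.length) + 180) := by
  set a := bitsToNat xs with ha
  set b := bitsToNat ys with hb
  set xa := encodeNat (a % 2 ^ W) with hxa
  set yb := encodeNat (b % 2 ^ W) with hyb
  have lxa : xa.length ≤ W := length_encodeNat_mod_two_pow_le _ _
  have lyb : yb.length ≤ W := length_encodeNat_mod_two_pow_le _ _
  -- reduce both operands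
  have h1 := runs_truncNorm r hT xs ys [] [] []
  have h2 := (runs_swapXY xa ys [] [] [] []).inr T
  have h3 := runs_truncNorm r hT ys xa [] [] []
  -- x := [], y := yb, z := xa
  have h4 := (runs_swapYZ yb xa [] [] [] []).inr T
  have h5 := (runs_swapXY yb [] xa [] [] []).inr T
  -- x := 2^W
  have h6 := runs_pow2X r hT yb xa [] [] []
  -- x := 2^W - yb
  have h7 := (runs_sub (encodeNat (2 ^ W)) yb xa).inr T
  have hborrow : subBorrow (encodeNat (2 ^ W)) yb = false := by
    rw [subBorrow_iff, hyb, bitsToNat_encodeNat, bitsToNat_encodeNat, decide_eq_false_iff_not, not_lt]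
    exact (Nat.mod_lt _ (Nat.two_pow_pos W)).le
  rw [hborrow] at h7
  simp only [Bool.not_false, cond_false] at h7
  set d := subRes (encodeNat (2 ^ W)) yb with hd
  have hle : bitsToNat yb ≤ bitsToNat (encodeNat (2 ^ W)) := by
    rw [hyb, bitsToNat_encodeNat, bitsToNat_encodeNat]; exact (Nat.mod_lt _ (Nat.two_pow_pos W)).le
  have hdval : bitsToNat d = 2 ^ W - b % 2 ^ W := by
    rw [hd, bitsToNat_subRes _ _ hle, bitsToNat_encodeNat, hyb, bitsToNat_encodeNat]
  have ld : d.length = W + 1 := by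
    rw [hd, length_subRes, encodeNat_two_pow]; simp
  have h8 := runs_clear (Sum.inr AReg.g : κ ⊕ AReg) (Sum.elim T (file d yb xa [] [] [] [] (flag true)))
  simp only [Sum.elim_inr, file_g, Sum.update_elim_inr, update_file_g, flag_true,
    List.length_singleton] at h8
  have h9 := runs_clear (Sum.inr AReg.y : κ ⊕ AReg) (Sum.elim T (file d yb xa [] [] [] [] []))
  simp only [Sum.elim_inr, file_y, Sum.update_elim_inr, update_file_y] at h9
  have h10 := (runs_swapYZ d [] xa [] [] []).inr T
  have h11 := (runs_add d xa [] [] []).inr T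
  have h12 := runs_clear (Sum.inr AReg.y : κ ⊕ AReg) (Sum.elim T (file (addRes d xa) xa [] [] [] [] [] []))
  simp only [Sum.elim_inr, file_y, Sum.update_elim_inr, update_file_y] at h12
  have h13 := runs_truncNorm r hT (addRes d xa) [] [] [] []
  have hxaval : bitsToNat xa = a % 2 ^ W := by rw [hxa, bitsToNat_encodeNat]
  rw [bitsToNat_addRes, hdval, hxaval, subW_arith] at h13
  refine (h1.seq (h2.seq (h3.seq (h4.seq (h5.seq (h6.seq (h7.seq (h8.seq (h9.seq (h10.seq
    (h11.seq (h12.seq h13)))))))))))).of_eq rfl ?_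
  have ladd := length_addRes_le d xa
  have l2 : (encodeNat (2 ^ W)).length = W + 1 := by rw [encodeNat_two_pow]; simp
  simp only [List.length_nil]
  omega

/-! ### Division and remainder -/

/-- The quotient register of `divOf` receives one bit per dividend bit. [folklore] -/
theorem length_divBits : ∀ (bs acc n qs : List Bool),
    (divBits bs acc n qs).length = bs.length + qs.length
  | [], _, _, qs => by simp [divBits]
  | b :: bs, acc, n, qs => by
    rw [divBits, length_divBits bs]; simp; omega

/-- `encodeNat b = []` forces `b = 0` (cf. `encodeNat_eq_nil_iff` in `RealTauConjectureDefinable.lean`, not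
importable here). [folklore] -/
theorem eq_zero_of_encodeNat_eq_nil {b : ℕ} (h : encodeNat b = []) : b = 0 := by
  have := bitsToNat_encodeNat b
  rw [h] at this
  simpa using this.symm

attribute [local simp] TokConv.encodeNat_zero'

/-- `encodeNat b = bit :: rest` forces `0 < b`. [folklore] -/
theorem pos_of_encodeNat_eq_cons {b : ℕ} {bit : Bool} {rest : List Bool}
    (h : encodeNat b = bit :: rest) : 0 < b := by
  rcases Nat.eq_zero_or_pos b with rfl | hb
  · rw [TokConv.encodeNat_zero'] at h; exact absurd h (by simp)
  · exact hb

/-- Cost bookkeeping of the zero tests. [folklore] -/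
theorem cost_pop_aux (X : ℕ) (hX : 1 ≤ X) : 1 + 45 * X ^ 2 + 2 ≤ 48 * X ^ 2 := by nlinarith

/-- `divPos`: for `y > 0`, `x := x / y`, `y` emptied (long division `divOf` over the bits of
`x`, most significant first; the quotient collected on `q` is moved back and normalised).
[folklore] -/
def divPos : Com (κ ⊕ AReg) :=
  pour (Sum.inr AReg.x) (Sum.inl r.m) ;; divOf r.m r.q ;;
  clear (Sum.inr AReg.x) ;; clear (Sum.inr AReg.y) ;;
  move (Sum.inl r.q) (Sum.inr AReg.x) (Sum.inr AReg.s) ;; bk normalize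

/-- Effect of `divPos` on numerals, `b > 0`. [folklore] -/
theorem runs_divPos {T : Regs κ} {W : ℕ} (hT : r.Clean T W) (xs ys : List Bool)
    (hb : 0 < bitsToNat ys) :
    Runs (divPos r) (Sum.elim T (file xs ys [] [] [] [] [] []))
      (Sum.elim T (file (encodeNat (bitsToNat xs / bitsToNat ys)) [] [] [] [] [] [] []))
      (45 * (xs.length + ys.length + 1) ^ 2) := by
  have h1 := runs_pour (a := (Sum.inr AReg.x : κ ⊕ AReg)) (b := Sum.inl r.m) (by simp)
    (Sum.elim T (file xs ys [] [] [] [] [] []))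
  simp only [Sum.elim_inr, file_x, Sum.update_elim_inr, update_file_x, Sum.elim_inl, hT.hm,
    List.append_nil, Sum.update_elim_inl] at h1
  have h2 := runs_divOf (κ := κ) (m := r.m) (q := r.q) r.m_q xs.reverse
    (Function.update T r.m xs.reverse) [] ys [] (by simp) (by simpa using hb) (by simp)
  have hTq : Function.update T r.m xs.reverse r.q = [] := by
    rw [Function.update_of_ne r.m_q.symm, hT.hq]
  rw [hTq, Function.update_idem] at h2
  have hT' : Function.update T r.m [] = T := by
    rw [← hT.hm]; exact Function.update_eq_self _ _
  rw [hT'] at h2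
  set D := divBits xs.reverse [] ys [] with hD
  set R := remOfRes xs.reverse [] ys with hR
  have lR : R.length ≤ ys.length := (remOfRes_lt_and_length xs.reverse [] ys (by simpa using hb) (by simp)).2
  have lD : D.length = xs.length := by rw [hD, length_divBits]; simp
  have hDval : bitsToNat D = bitsToNat xs / bitsToNat ys := by
    have := (divOf_div_mod xs.reverse ys hb).1
    rwa [List.reverse_reverse] at this
  have h3 := runs_clear (Sum.inr AReg.x : κ ⊕ AReg)
    (Sum.elim (Function.update T r.q D) (file R ys [] [] [] [] [] []))
  simp only [Sum.elim_inr, file_x, Sum.update_elim_inr, update_file_x] at h3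
  have h4 := runs_clear (Sum.inr AReg.y : κ ⊕ AReg)
    (Sum.elim (Function.update T r.q D) (file [] ys [] [] [] [] [] []))
  simp only [Sum.elim_inr, file_y, Sum.update_elim_inr, update_file_y] at h4
  have h5 := runs_move (a := (Sum.inl r.q : κ ⊕ AReg)) (b := Sum.inr AReg.x) (t := Sum.inr AReg.s)
    (by simp) (by simp) (by simp) (Sum.elim (Function.update T r.q D) (file [] [] [] [] [] [] [] []))
    (by simp)
  simp only [Sum.elim_inl, Function.update_self, Sum.elim_inr, file_x, List.append_nil,
    Sum.update_elim_inl, Function.update_idem, Sum.update_elim_inr, update_file_x] at h5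
  have hT'' : Function.update T r.q [] = T := by
    rw [← hT.hq]; exact Function.update_eq_self _ _
  rw [hT''] at h5
  have h6 := (runs_normalize D [] [] [] [] []).inr T
  rw [norm_eq_encodeNat, hDval] at h6
  refine (h1.seq (h2.seq (h3.seq (h4.seq (h5.seq h6))))).of_eq rfl ?_
  simp only [List.length_reverse]
  set a := xs.length
  set b := ys.length
  have : R.length ≤ b := lR
  nlinarith [lR, lD]

/-- `divW`: `x := x / y` with `x / 0 = 0`, `y` emptied (test `y = 0` on the canonical numeral,
then `divPos`). [folklore] -/
def divW : Com (κ ⊕ AReg) :=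
  pop (Sum.inr AReg.y) (push (Sum.inr AReg.y) true ;; divPos r) (push (Sum.inr AReg.y) false ;; divPos r)
    (clear (Sum.inr AReg.x))

/-- Effect of `divW` on canonical numerals. [folklore] -/
theorem runs_divW {T : Regs κ} {W : ℕ} (hT : r.Clean T W) (xs : List Bool) (b : ℕ) :
    Runs (divW r) (Sum.elim T (file xs (encodeNat b) [] [] [] [] [] []))
      (Sum.elim T (file (encodeNat (bitsToNat xs / b)) [] [] [] [] [] [] []))
      (48 * (xs.length + (encodeNat b).length + 1) ^ 2) := by
  rcases hys : encodeNat b with _ | ⟨bit, rest⟩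
  · have hb0 : b = 0 := eq_zero_of_encodeNat_eq_nil hys
    subst hb0
    have h := runs_clear (Sum.inr AReg.x : κ ⊕ AReg) (Sum.elim T (file xs [] [] [] [] [] [] []))
    simp only [Sum.elim_inr, file_x, Sum.update_elim_inr, update_file_x] at h
    refine (Runs.pop_nil _ _ (by simp) h).of_eq (by simp) ?_
    simp only [List.length_nil]
    nlinarith [Nat.zero_le xs.length]
  · have hb : 0 < b := pos_of_encodeNat_eq_cons hys
    have hval : bitsToNat (bit :: rest) = b := by rw [← hys, bitsToNat_encodeNat]
    have hpush : Runs (push (Sum.inr AReg.y) bit : Com (κ ⊕ AReg))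
        (Sum.elim T (file xs rest [] [] [] [] [] [])) (Sum.elim T (file xs (bit :: rest) [] [] [] [] [] [])) 1 :=
      Runs.push' (by simp only [Sum.update_elim_inr, Sum.elim_inr, file_y, update_file_y])
    have hdiv := runs_divPos r hT xs (bit :: rest) (by rw [hval]; exact hb)
    rw [hval] at hdiv
    have hk : (Sum.elim T (file xs (bit :: rest) [] [] [] [] [] []) : Regs (κ ⊕ AReg)) (Sum.inr AReg.y) =
        bit :: rest := by simp
    have hupd : Function.update (Sum.elim T (file xs (bit :: rest) [] [] [] [] [] []) : Regs (κ ⊕ AReg))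
        (Sum.inr AReg.y) rest = Sum.elim T (file xs rest [] [] [] [] [] []) := by
      simp only [Sum.update_elim_inr, update_file_y]
    have hc := cost_pop_aux (xs.length + (bit :: rest).length + 1) (by omega)
    cases bit
    · exact (Runs.pop_false' _ _ hk hupd (hpush.seq hdiv)).of_eq rfl hc
    · exact (Runs.pop_true' _ _ hk hupd (hpush.seq hdiv)).of_eq rfl hc

/-- `modPos`: for `y > 0`, `x := x mod y`, `y` emptied (`remOf` over the bits of `x`, most
significant first). [folklore] -/
def modPos : Com (κ ⊕ AReg) :=
  pour (Sum.inr AReg.x) (Sum.inl r.m) ;; remOf r.m ;; clear (Sum.inr AReg.y) ;; bk normalize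

/-- Effect of `modPos` on numerals, `b > 0`. [folklore] -/
theorem runs_modPos {T : Regs κ} {W : ℕ} (hT : r.Clean T W) (xs ys : List Bool)
    (hb : 0 < bitsToNat ys) :
    Runs (modPos r) (Sum.elim T (file xs ys [] [] [] [] [] []))
      (Sum.elim T (file (encodeNat (bitsToNat xs % bitsToNat ys)) [] [] [] [] [] [] []))
      (45 * (xs.length + ys.length + 1) ^ 2) := by
  have h1 := runs_pour (a := (Sum.inr AReg.x : κ ⊕ AReg)) (b := Sum.inl r.m) (by simp)
    (Sum.elim T (file xs ys [] [] [] [] [] []))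
  simp only [Sum.elim_inr, file_x, Sum.update_elim_inr, update_file_x, Sum.elim_inl, hT.hm,
    List.append_nil, Sum.update_elim_inl] at h1
  have h2 := runs_remOf (κ := κ) r.m xs.reverse (Function.update T r.m xs.reverse) [] ys []
    (by simp) (by simpa using hb) (by simp)
  rw [Function.update_idem] at h2
  have hT' : Function.update T r.m [] = T := by
    rw [← hT.hm]; exact Function.update_eq_self _ _
  rw [hT'] at h2
  set R := remOfRes xs.reverse [] ys with hR
  have lR : R.length ≤ ys.length := (remOfRes_lt_and_length xs.reverse [] ys (by simpa using hb) (by simp)).2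
  have hRval : bitsToNat R = bitsToNat xs % bitsToNat ys := by
    have := bitsToNat_remOfRes_nil xs.reverse ys hb
    rwa [List.reverse_reverse] at this
  have h3 := runs_clear (Sum.inr AReg.y : κ ⊕ AReg) (Sum.elim T (file R ys [] [] [] [] [] []))
  simp only [Sum.elim_inr, file_y, Sum.update_elim_inr, update_file_y] at h3
  have h4 := (runs_normalize R [] [] [] [] []).inr T
  rw [norm_eq_encodeNat, hRval] at h4
  refine (h1.seq (h2.seq (h3.seq h4))).of_eq rfl ?_
  simp only [List.length_reverse]
  nlinarith [lR]

/-- `modW`: `x := x mod y` with `x mod 0 = x`, `y` emptied. [folklore] -/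
def modW : Com (κ ⊕ AReg) :=
  pop (Sum.inr AReg.y) (push (Sum.inr AReg.y) true ;; modPos r) (push (Sum.inr AReg.y) false ;; modPos r)
    skip

/-- Effect of `modW` on canonical numerals. [folklore] -/
theorem runs_modW {T : Regs κ} {W : ℕ} (hT : r.Clean T W) (a b : ℕ) :
    Runs (modW r) (Sum.elim T (file (encodeNat a) (encodeNat b) [] [] [] [] [] []))
      (Sum.elim T (file (encodeNat (a % b)) [] [] [] [] [] [] []))
      (48 * ((encodeNat a).length + (encodeNat b).length + 1) ^ 2) := by
  rcases hys : encodeNat b with _ | ⟨bit, rest⟩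
  · have hb0 : b = 0 := eq_zero_of_encodeNat_eq_nil hys
    subst hb0
    refine (Runs.pop_nil _ _ (by simp) (Runs.skip _)).of_eq (by simp) ?_
    simp only [List.length_nil]
    nlinarith [Nat.zero_le (encodeNat a).length]
  · have hb : 0 < b := pos_of_encodeNat_eq_cons hys
    have hval : bitsToNat (bit :: rest) = b := by rw [← hys, bitsToNat_encodeNat]
    have hpush : Runs (push (Sum.inr AReg.y) bit : Com (κ ⊕ AReg))
        (Sum.elim T (file (encodeNat a) rest [] [] [] [] [] []))
        (Sum.elim T (file (encodeNat a) (bit :: rest) [] [] [] [] [] [])) 1 :=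
      Runs.push' (by simp only [Sum.update_elim_inr, Sum.elim_inr, file_y, update_file_y])
    have hmod := runs_modPos r hT (encodeNat a) (bit :: rest) (by rw [hval]; exact hb)
    rw [hval, bitsToNat_encodeNat] at hmod
    have hk : (Sum.elim T (file (encodeNat a) (bit :: rest) [] [] [] [] [] []) : Regs (κ ⊕ AReg))
        (Sum.inr AReg.y) = bit :: rest := by simp
    have hupd : Function.update (Sum.elim T (file (encodeNat a) (bit :: rest) [] [] [] [] [] []) :
        Regs (κ ⊕ AReg)) (Sum.inr AReg.y) rest = Sum.elim T (file (encodeNat a) rest [] [] [] [] [] []) := by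
      simp only [Sum.update_elim_inr, update_file_y]
    have hc := cost_pop_aux ((encodeNat a).length + (bit :: rest).length + 1) (by omega)
    cases bit
    · exact (Runs.pop_false' _ _ hk hupd (hpush.seq hmod)).of_eq rfl hc
    · exact (Runs.pop_true' _ _ hk hupd (hpush.seq hmod)).of_eq rfl hc

/-! ### Bitwise operations on words -/

/-- `bandW`: `x := x &&& y`, `y` emptied. [folklore] -/
def bandW : Com (κ ⊕ AReg) := bk (zipC (· && ·))

/-- Effect of `bandW`. [folklore] -/
theorem runs_bandW (T : Regs κ) (xs ys : List Bool) :
    Runs (bandW : Com (κ ⊕ AReg)) (Sum.elim T (file xs ys [] [] [] [] [] []))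
      (Sum.elim T (file (encodeNat (bitsToNat xs &&& bitsToNat ys)) [] [] [] [] [] [] []))
      (17 * (xs.length + ys.length) + 8) := by
  have h := (runs_zipC (· && ·) xs ys [] [] [] []).inr T
  rwa [norm_eq_encodeNat, bitsToNat_zipBits_and] at h

/-- `borW`: `x := (x ||| y) mod 2^W`, `y` emptied. [folklore] -/
def borW : Com (κ ⊕ AReg) := bk (zipC (· || ·)) ;; truncNorm r

/-- Effect of `borW`. [folklore] -/
theorem runs_borW {T : Regs κ} {W : ℕ} (hT : r.Clean T W) (xs ys : List Bool) :
    Runs (borW r) (Sum.elim T (file xs ys [] [] [] [] [] []))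
      (Sum.elim T (file (encodeNat ((bitsToNat xs ||| bitsToNat ys) % 2 ^ W)) [] [] [] [] [] [] []))
      (46 * (W + xs.length + ys.length) + 19) := by
  have h1 := (runs_zipC (· || ·) xs ys [] [] [] []).inr T
  have h2 := runs_truncNorm r hT (norm (zipBits (· || ·) xs ys)) [] [] [] []
  rw [bitsToNat_norm, bitsToNat_zipBits_or] at h2
  refine (h1.seq h2).of_eq rfl ?_
  have l1 := length_norm_le (zipBits (· || ·) xs ys)
  have l2 := length_zipBits (· || ·) xs ys
  have l3 : max xs.length ys.length ≤ xs.length + ys.length :=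
    max_le (Nat.le_add_right _ _) (Nat.le_add_left _ _)
  omega

/-- `bxorW`: `x := (x ^^^ y) mod 2^W`, `y` emptied. [folklore] -/
def bxorW : Com (κ ⊕ AReg) := bk (zipC Bool.xor) ;; truncNorm r

/-- Effect of `bxorW`. [folklore] -/
theorem runs_bxorW {T : Regs κ} {W : ℕ} (hT : r.Clean T W) (xs ys : List Bool) :
    Runs (bxorW r) (Sum.elim T (file xs ys [] [] [] [] [] []))
      (Sum.elim T (file (encodeNat ((bitsToNat xs ^^^ bitsToNat ys) % 2 ^ W)) [] [] [] [] [] [] []))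
      (46 * (W + xs.length + ys.length) + 19) := by
  have h1 := (runs_zipC Bool.xor xs ys [] [] [] []).inr T
  have h2 := runs_truncNorm r hT (norm (zipBits Bool.xor xs ys)) [] [] [] []
  rw [bitsToNat_norm, bitsToNat_zipBits_xor] at h2
  refine (h1.seq h2).of_eq rfl ?_
  have l1 := length_norm_le (zipBits Bool.xor xs ys)
  have l2 := length_zipBits Bool.xor xs ys
  have l3 : max xs.length ys.length ≤ xs.length + ys.length :=
    max_le (Nat.le_add_right _ _) (Nat.le_add_left _ _)
  omega

/-! ### Comparisons -/

/-- `ltW`: `x := [x < y]` as a numeral (`1`/`0`), `y` emptied: the borrow of a subtraction.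
[folklore] -/
def ltW : Com (κ ⊕ AReg) :=
  bk sub ;; clear (Sum.inr AReg.x) ;; clear (Sum.inr AReg.y) ;;
  pop (Sum.inr AReg.g) skip skip (push (Sum.inr AReg.x) true)

/-- Effect of `ltW`. [folklore] -/
theorem runs_ltW (T : Regs κ) (xs ys : List Bool) :
    Runs (ltW : Com (κ ⊕ AReg)) (Sum.elim T (file xs ys [] [] [] [] [] []))
      (Sum.elim T (file (encodeNat (if bitsToNat xs < bitsToNat ys then 1 else 0)) [] [] [] [] [] [] []))
      (18 * (xs.length + ys.length) + 17) := by
  have h1 := (runs_sub xs ys []).inr T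
  set d := (bif subBorrow xs ys then xs else subRes xs ys) with hd
  have ld : d.length = xs.length := by
    rw [hd]; cases subBorrow xs ys <;> simp [length_subRes]
  have h2 := runs_clear (Sum.inr AReg.x : κ ⊕ AReg) (Sum.elim T (file d ys [] [] [] [] [] (flag !subBorrow xs ys)))
  simp only [Sum.elim_inr, file_x, Sum.update_elim_inr, update_file_x] at h2
  have h3 := runs_clear (Sum.inr AReg.y : κ ⊕ AReg) (Sum.elim T (file [] ys [] [] [] [] [] (flag !subBorrow xs ys)))
  simp only [Sum.elim_inr, file_y, Sum.update_elim_inr, update_file_y] at h3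
  have h4 : Runs (pop (Sum.inr AReg.g) skip skip (push (Sum.inr AReg.x) true) : Com (κ ⊕ AReg))
      (Sum.elim T (file [] [] [] [] [] [] [] (flag !subBorrow xs ys)))
      (Sum.elim T (file (encodeNat (if bitsToNat xs < bitsToNat ys then 1 else 0)) [] [] [] [] [] [] [])) 3 := by
    rw [subBorrow_iff]
    by_cases hlt : bitsToNat xs < bitsToNat ys
    · rw [if_pos hlt, decide_eq_true hlt]
      refine (Runs.pop_nil _ _ (by simp) (Runs.push' ?_)).of_eq rfl (by norm_num)
      simp only [Sum.update_elim_inr, Sum.elim_inr, file_x, update_file_x]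
      rfl
    · rw [if_neg hlt, decide_eq_false hlt]
      refine (Runs.pop_true' _ _ (w := []) (R₀ := Sum.elim T (file [] [] [] [] [] [] [] [])) (by simp) ?_
        (Runs.skip _)).of_eq (by simp) (by norm_num)
      simp only [Bool.not_false, flag_true, Sum.update_elim_inr, update_file_g]
  refine (h1.seq (h2.seq (h3.seq h4))).of_eq rfl ?_
  omega

/-- Canonical numerals are equal iff their values are (the `Iff` form of the `encodeNat_injective` twins in
`QuantumCircuit.lean` / `ExhaustiveSatRounds.lean`, not importable here). [folklore] -/
theorem encodeNat_inj_iff {a b : ℕ} : encodeNat a = encodeNat b ↔ a = b :=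
  ⟨fun h => by rw [← bitsToNat_encodeNat a, h, bitsToNat_encodeNat], fun h => by rw [h]⟩

/-- `eqW`: `x := [x = y]` as a numeral (`1`/`0`) for canonical operands, `y` emptied: string
equality `eqCheck`. [folklore] -/
def eqW : Com (κ ⊕ AReg) :=
  eqCheck (Sum.inr AReg.x) (Sum.inr AReg.y) (Sum.inr AReg.g) ;;
  pop (Sum.inr AReg.g) (push (Sum.inr AReg.x) true) skip skip

/-- Effect of `eqW` on canonical numerals. [folklore] -/
theorem runs_eqW (T : Regs κ) (a b : ℕ) :
    Runs (eqW : Com (κ ⊕ AReg)) (Sum.elim T (file (encodeNat a) (encodeNat b) [] [] [] [] [] []))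
      (Sum.elim T (file (encodeNat (if a = b then 1 else 0)) [] [] [] [] [] [] []))
      (7 * ((encodeNat a).length + (encodeNat b).length) + 12) := by
  have h1 := runs_eqCheck (a := (Sum.inr AReg.x : κ ⊕ AReg)) (b := Sum.inr AReg.y) (F := Sum.inr AReg.g)
    (by simp) (by simp) (by simp) (Sum.elim T (file (encodeNat a) (encodeNat b) [] [] [] [] [] []))
  simp only [Sum.elim_inr, file_g, List.length_nil, zero_mul, zero_add, file_x, file_y,
    Sum.update_elim_inr, update_file_x, update_file_y, update_file_g, encodeNat_inj_iff] at h1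
  have h2 : Runs (pop (Sum.inr AReg.g) (push (Sum.inr AReg.x) true) skip skip : Com (κ ⊕ AReg))
      (Sum.elim T (file [] [] [] [] [] [] [] (flag (decide (a = b)))))
      (Sum.elim T (file (encodeNat (if a = b then 1 else 0)) [] [] [] [] [] [] [])) 3 := by
    by_cases hab : a = b
    · rw [if_pos hab, decide_eq_true hab]
      refine (Runs.pop_true' _ _ (w := []) (R₀ := Sum.elim T (file [] [] [] [] [] [] [] [])) (by simp) ?_
        (Runs.push' ?_)).of_eq rfl (by norm_num)
      · simp only [flag_true, Sum.update_elim_inr, update_file_g]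
      · simp only [Sum.update_elim_inr, Sum.elim_inr, file_x, update_file_x]; rfl
    · rw [if_neg hab, decide_eq_false hab]
      exact (Runs.pop_nil _ _ (by simp) (Runs.skip _)).of_eq (by simp) (by norm_num)
  refine (h1.seq h2).of_eq rfl ?_
  omega

/-! ### Capping a binary count by a unary bound -/

/-- A lower bound for the most-significant-bit-first reading `UnLeBin.msbVal` (from
`UnLeBin.msbVal_reverse`). [folklore] -/
theorem le_msbVal (p : ℕ) (V : List Bool) : p ≤ UnLeBin.msbVal p V := by
  have h := UnLeBin.msbVal_reverse p V.reverse
  rw [List.reverse_reverse, List.length_reverse] at h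
  rw [h]
  exact le_trans (Nat.le_mul_of_pos_right _ (Nat.two_pow_pos _)) (Nat.le_add_right _ _)

/-- The Horner loop: for each bit of `p` (most significant first) double the counter `c` and add
the bit. [folklore] -/
def hornerLoop : Com (κ ⊕ AReg) :=
  loop (Sum.inl r.p) (dblReg (Sum.inl r.c) (Sum.inr AReg.s) ;; push (Sum.inl r.c) true)
    (dblReg (Sum.inl r.c) (Sum.inr AReg.s))

/-- Simulation of the Horner loop: `c := 1^{msbVal k p}` (`UnLeBin.msbVal`: the bits of `p` read most
significant first on top of the accumulator `k`) from `c = 1^k`, `p` emptied, provided the final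
value is at most `B` (cost `≤ |p| (20 B + 5) + 1`). [folklore] -/
theorem runs_hornerLoop : ∀ (bs : List Bool) (T : Regs κ) (k B : ℕ) (x0 y0 z0 t0 u0 f0 g0 : List Bool),
    T r.p = bs → T r.c = ones k → UnLeBin.msbVal k bs ≤ B →
    Runs (hornerLoop r) (Sum.elim T (file x0 y0 z0 [] t0 u0 f0 g0))
      (Sum.elim (Function.update (Function.update T r.p []) r.c (ones (UnLeBin.msbVal k bs)))
        (file x0 y0 z0 [] t0 u0 f0 g0))
      (bs.length * (20 * B + 5) + 1)
  | [], T, k, B, x0, y0, z0, t0, u0, f0, g0, hp, hc, _ => by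
    refine (Runs.loop_nil _ _ (by simp [hp])).of_eq ?_ (by simp)
    have e1 : Function.update T r.p [] = T := by rw [← hp]; exact Function.update_eq_self _ _
    rw [e1]
    have e2 : Function.update T r.c (ones (UnLeBin.msbVal k [])) = T := by
      have : UnLeBin.msbVal k [] = k := rfl
      rw [this, ← hc]; exact Function.update_eq_self _ _
    rw [e2]
  | b :: bs, T, k, B, x0, y0, z0, t0, u0, f0, g0, hp, hc, hB => by
    have hk : (Sum.elim T (file x0 y0 z0 [] t0 u0 f0 g0) : Regs (κ ⊕ AReg)) (Sum.inl r.p) = b :: bs := by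
      simp [hp]
    -- the new counter value after this bit is `2 k + b`
    have hval : UnLeBin.msbVal k (b :: bs) = UnLeBin.msbVal (2 * k + b.toNat) bs := rfl
    have hk'B : 2 * k + b.toNat ≤ B := le_trans (le_msbVal _ bs) (hval ▸ hB)
    have hkB : 2 * k ≤ B := by have := Bool.toNat_le b; omega
    -- body: double, then maybe push
    have hd := runs_dblReg (p := (Sum.inl r.c : κ ⊕ AReg)) (t := Sum.inr AReg.s) (by simp)
      (Function.update (Sum.elim T (file x0 y0 z0 [] t0 u0 f0 g0)) (Sum.inl r.p) bs) (by simp)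
    simp only [Sum.update_elim_inl, Sum.elim_inl, ne_eq, r.c_p, not_false_eq_true,
      Function.update_of_ne, hc, List.length_replicate] at hd
    have hbody : Runs (bif b then (dblReg (Sum.inl r.c) (Sum.inr AReg.s) ;; push (Sum.inl r.c) true)
          else dblReg (Sum.inl r.c) (Sum.inr AReg.s) : Com (κ ⊕ AReg))
        (Sum.elim (Function.update T r.p bs) (file x0 y0 z0 [] t0 u0 f0 g0))
        (Sum.elim (Function.update (Function.update T r.p bs) r.c (ones (2 * k + b.toNat)))
          (file x0 y0 z0 [] t0 u0 f0 g0))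
        (10 * k + 2 + 1) := by
      cases b
      · simp only [cond_false, Bool.toNat_false, add_zero]
        exact hd.of_eq rfl (by omega)
      · simp only [cond_true, Bool.toNat_true]
        refine (hd.seq (Runs.push (Sum.inl r.c) true _)).of_eq ?_ le_rfl
        simp only [Sum.update_elim_inl, Sum.elim_inl, Function.update_self, Function.update_idem]
        rfl
    have ih := runs_hornerLoop bs (Function.update (Function.update T r.p bs) r.c (ones (2 * k + b.toNat)))
      (2 * k + b.toNat) B x0 y0 z0 t0 u0 f0 g0
      (by rw [Function.update_of_ne r.c_p.symm, Function.update_self])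
      (by rw [Function.update_self]) (hval ▸ hB)
    have hfin : Function.update (Function.update (Function.update (Function.update T r.p bs) r.c
        (ones (2 * k + b.toNat))) r.p []) r.c (ones (UnLeBin.msbVal (2 * k + b.toNat) bs)) =
        Function.update (Function.update T r.p []) r.c (ones (UnLeBin.msbVal k (b :: bs))) := by
      rw [hval]
      funext i
      by_cases h1 : i = r.c
      · subst h1; simp
      · by_cases h2 : i = r.p
        · subst h2; simp [h1]
        · simp [h1, h2]
    rw [hfin] at ih
    have hcost : 10 * k + 2 + 1 + 2 + (bs.length * (20 * B + 5) + 1) ≤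
        (b :: bs).length * (20 * B + 5) + 1 := by
      simp only [List.length_cons]; nlinarith
    have hbody' : Runs (bif b then (dblReg (Sum.inl r.c) (Sum.inr AReg.s) ;; push (Sum.inl r.c) true)
          else dblReg (Sum.inl r.c) (Sum.inr AReg.s) : Com (κ ⊕ AReg))
        (Function.update (Sum.elim T (file x0 y0 z0 [] t0 u0 f0 g0)) (Sum.inl r.p) bs)
        (Sum.elim (Function.update (Function.update T r.p bs) r.c (ones (2 * k + b.toNat)))
          (file x0 y0 z0 [] t0 u0 f0 g0))
        (10 * k + 2 + 1) := by
      rw [Sum.update_elim_inl]; exact hbody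
    cases b
    · exact (Runs.loop_false hk (by simpa only [cond_false] using hbody') ih).of_eq rfl hcost
    · exact (Runs.loop_true hk (by simpa only [cond_true] using hbody') ih).of_eq rfl hcost

/-- `capUnary`: with the bound `1^C` in `c`, the numeral of `b` in `y` and an operand parked in
`x`: `c := 1^{min b C}`, `y` emptied, `x` preserved. The bound is converted to binary (`toBin`),
compared with `b` by a subtraction; if `b` is smaller it is converted to unary by the Horner
loop, otherwise the saved copy of the bound is the answer. [folklore] -/
def capUnary : Com (κ ⊕ AReg) :=
  bk swapXY ;; bk swapYZ ;;
  copy (Sum.inl r.c) (Sum.inl r.c2) (Sum.inr .s) (Sum.inr .t) ;;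
  toBin (Sum.inl r.c) (Sum.inr AReg.y) (Sum.inr AReg.s) (Sum.inr AReg.t) (Sum.inr AReg.f) ;;
  bk sub ;;
  pop (Sum.inr AReg.g)
    (clear (Sum.inr AReg.x) ;; clear (Sum.inr AReg.y) ;; move (Sum.inl r.c2) (Sum.inl r.c) (Sum.inr AReg.s))
    skip
    (pour (Sum.inr AReg.x) (Sum.inl r.p) ;; hornerLoop r ;; clear (Sum.inr AReg.y) ;; clear (Sum.inl r.c2)) ;;
  bk swapYZ ;; bk swapXY

/-- Effect of `capUnary`, in `≤ 60 (C + 1)^2 + 40 (|x| + |encodeNat b|) + 60` steps. [folklore] -/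
theorem runs_capUnary {T : Regs κ} {C : ℕ} (hc : T r.c = ones C) (hc2 : T r.c2 = []) (hp : T r.p = [])
    (xs : List Bool) (b : ℕ) :
    Runs (capUnary r) (Sum.elim T (file xs (encodeNat b) [] [] [] [] [] []))
      (Sum.elim (Function.update T r.c (ones (min b C))) (file xs [] [] [] [] [] [] []))
      (60 * (C + 1) ^ 2 + 40 * (xs.length + (encodeNat b).length) + 60) := by
  set yb := encodeNat b with hyb
  have lC : (encodeNat C).length ≤ C := by
    apply length_encodeNat_le_of_lt; exact Nat.lt_two_pow_self
  -- park the operand in `z`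
  have h1 := (runs_swapXY xs yb [] [] [] []).inr T
  have h2 := (runs_swapYZ yb xs [] [] [] []).inr T
  -- save the bound and convert it to binary
  have h3 := runs_copy (a := (Sum.inl r.c : κ ⊕ AReg)) (b := Sum.inl r.c2) (t := Sum.inr AReg.s)
    (u := Sum.inr AReg.t) (by simp [r.c_c2]) (by simp) (by simp) (by simp) (by simp) (by simp)
    (Sum.elim T (file yb [] xs [] [] [] [] [])) (by simp) (by simp)
  simp only [Sum.elim_inl, hc, hc2, List.append_nil, Sum.update_elim_inl] at h3
  have h4 := runs_toBin (u := (Sum.inl r.c : κ ⊕ AReg)) (B := Sum.inr AReg.y) (t := Sum.inr AReg.s)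
    (t2 := Sum.inr AReg.t) (fl := Sum.inr AReg.f) (by simp) (by simp) (by simp) (by simp) (by simp)
    (by simp) (by simp) (by simp) (by simp) (by simp) C 0
    (Sum.elim (Function.update T r.c2 (ones C)) (file yb [] xs [] [] [] [] []))
    (by simp [r.c_c2, hc]) (by simp) (by simp) (by simp) (by simp)
  simp only [zero_add, Sum.update_elim_inl, Sum.update_elim_inr, update_file_y] at h4
  -- compare
  have h5 := (runs_sub yb (encodeNat C) xs).inr (Function.update (Function.update T r.c2 (ones C)) r.c [])
  rw [subBorrow_iff, hyb, bitsToNat_encodeNat, bitsToNat_encodeNat] at h5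
  set T1 := Function.update (Function.update T r.c2 (ones C)) r.c [] with hT1
  -- final rearrangement, common to both branches
  have hfinal : ∀ (T2 : Regs κ), Runs (bk swapYZ ;; bk swapXY : Com (κ ⊕ AReg))
      (Sum.elim T2 (file [] [] xs [] [] [] [] [])) (Sum.elim T2 (file xs [] [] [] [] [] [] []))
      (6 * xs.length + 4 + (6 * xs.length + 4)) := fun T2 => by
    have ha := (runs_swapYZ [] [] xs [] [] []).inr T2
    have hb := (runs_swapXY [] xs [] [] [] []).inr T2
    exact (ha.seq hb).of_eq rfl (by simp)
  by_cases hlt : b < C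
  · -- `b < C`: convert `b` to unary
    rw [decide_eq_true hlt] at h5
    simp only [cond_true, Bool.not_true, flag_false] at h5
    have h6 := runs_pour (a := (Sum.inr AReg.x : κ ⊕ AReg)) (b := Sum.inl r.p) (by simp)
      (Sum.elim T1 (file (encodeNat b) (encodeNat C) xs [] [] [] [] []))
    have hT1p : T1 r.p = [] := by simp [hT1, r.c_p.symm, r.c2_p.symm, hp]
    have hT1c : T1 r.c = [] := by simp [hT1]
    simp only [Sum.elim_inr, file_x, Sum.update_elim_inr, update_file_x, Sum.elim_inl, hT1p,
      List.append_nil, Sum.update_elim_inl] at h6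
    have hmsb : UnLeBin.msbVal 0 (encodeNat b).reverse = b := by
      rw [UnLeBin.msbVal_reverse, bitsToNat_encodeNat]; simp
    have h7 := runs_hornerLoop r (encodeNat b).reverse (Function.update T1 r.p (encodeNat b).reverse) 0 C
      [] (encodeNat C) xs [] [] [] [] (by simp) (by simp [r.c_p, hT1c]) (by rw [hmsb]; exact hlt.le)
    simp only [hmsb, Function.update_idem, List.length_reverse] at h7
    have h8 := runs_clear (Sum.inr AReg.y : κ ⊕ AReg)
      (Sum.elim (Function.update (Function.update T1 r.p []) r.c (ones b)) (file [] (encodeNat C) xs [] [] [] [] []))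
    simp only [Sum.elim_inr, file_y, Sum.update_elim_inr, update_file_y] at h8
    have h9 := runs_clear (Sum.inl r.c2 : κ ⊕ AReg)
      (Sum.elim (Function.update (Function.update T1 r.p []) r.c (ones b)) (file [] [] xs [] [] [] [] []))
    have hc2val : Function.update (Function.update T1 r.p []) r.c (ones b) r.c2 = ones C := by
      simp [hT1, r.c_c2.symm, r.c2_p]
    simp only [Sum.elim_inl, hc2val, List.length_replicate, Sum.update_elim_inl] at h9
    set T2 := Function.update (Function.update (Function.update T1 r.p []) r.c (ones b)) r.c2 [] with hT2
    have hT2eq : T2 = Function.update T r.c (ones (min b C)) := by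
      rw [min_eq_left hlt.le, hT2, hT1]
      funext i
      by_cases h1 : i = r.c
      · subst h1; simp [r.c_c2]
      · by_cases h2 : i = r.c2
        · subst h2; simp [h1, hc2]
        · by_cases h3 : i = r.p
          · subst h3; simp [h1, h2, hp]
          · simp [h1, h2, h3]
    have hbranch : Runs (pop (Sum.inr AReg.g)
        (clear (Sum.inr AReg.x) ;; clear (Sum.inr AReg.y) ;; move (Sum.inl r.c2) (Sum.inl r.c) (Sum.inr AReg.s))
        skip
        (pour (Sum.inr AReg.x) (Sum.inl r.p) ;; hornerLoop r ;; clear (Sum.inr AReg.y) ;; clear (Sum.inl r.c2)) :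
          Com (κ ⊕ AReg))
        (Sum.elim T1 (file (encodeNat b) (encodeNat C) xs [] [] [] [] []))
        (Sum.elim T2 (file [] [] xs [] [] [] [] []))
        (3 * (encodeNat b).length + 1 + ((encodeNat b).length * (20 * C + 5) + 1 +
          (2 * (encodeNat C).length + 1 + (2 * C + 1))) + 2) :=
      Runs.pop_nil _ _ (by simp) (h6.seq (h7.seq (h8.seq h9)))
    rw [hT2eq] at hbranch
    refine (h1.seq (h2.seq (h3.seq (h4.seq (h5.seq (hbranch.seq (hfinal _))))))).of_eq rfl ?_
    have lb : (encodeNat b).length ≤ C := (length_encodeNat_le_of_lt (hlt.trans Nat.lt_two_pow_self))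
    simp only [List.length_nil, List.length_replicate]
    nlinarith [lb, lC]
  · -- `C ≤ b`: the saved bound is the answer
    rw [decide_eq_false hlt] at h5
    simp only [cond_false, Bool.not_false, flag_true] at h5
    set d := subRes (encodeNat b) (encodeNat C) with hd
    have ld : d.length = (encodeNat b).length := length_subRes _ _
    have h6 := runs_clear (Sum.inr AReg.x : κ ⊕ AReg) (Sum.elim T1 (file d (encodeNat C) xs [] [] [] [] []))
    simp only [Sum.elim_inr, file_x, Sum.update_elim_inr, update_file_x] at h6
    have h7 := runs_clear (Sum.inr AReg.y : κ ⊕ AReg) (Sum.elim T1 (file [] (encodeNat C) xs [] [] [] [] []))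
    simp only [Sum.elim_inr, file_y, Sum.update_elim_inr, update_file_y] at h7
    have h8 := runs_move (a := (Sum.inl r.c2 : κ ⊕ AReg)) (b := Sum.inl r.c) (t := Sum.inr AReg.s)
      (by simp [r.c_c2.symm]) (by simp) (by simp) (Sum.elim T1 (file [] [] xs [] [] [] [] [])) (by simp)
    have hT1c2 : T1 r.c2 = ones C := by simp [hT1, r.c_c2.symm]
    have hT1c : T1 r.c = [] := by simp [hT1]
    simp only [Sum.elim_inl, hT1c2, hT1c, List.append_nil, Sum.update_elim_inl, List.length_replicate] at h8
    set T2 := Function.update (Function.update T1 r.c2 []) r.c (ones C) with hT2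
    have hT2eq : T2 = Function.update T r.c (ones (min b C)) := by
      rw [min_eq_right (not_lt.1 hlt), hT2, hT1]
      funext i
      by_cases h1 : i = r.c
      · subst h1; simp
      · by_cases h2 : i = r.c2
        · subst h2; simp [h1, hc2]
        · simp [h1, h2]
    have hbranch : Runs (pop (Sum.inr AReg.g)
        (clear (Sum.inr AReg.x) ;; clear (Sum.inr AReg.y) ;; move (Sum.inl r.c2) (Sum.inl r.c) (Sum.inr AReg.s))
        skip
        (pour (Sum.inr AReg.x) (Sum.inl r.p) ;; hornerLoop r ;; clear (Sum.inr AReg.y) ;; clear (Sum.inl r.c2)) :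
          Com (κ ⊕ AReg))
        (Sum.elim T1 (file d (encodeNat C) xs [] [] [] [] [true]))
        (Sum.elim T2 (file [] [] xs [] [] [] [] []))
        (2 * d.length + 1 + (2 * (encodeNat C).length + 1 + (6 * C + 2)) + 2) :=
      Runs.pop_true' _ _ (w := []) (R₀ := Sum.elim T1 (file d (encodeNat C) xs [] [] [] [] [])) (by simp)
        (by simp only [Sum.update_elim_inr, update_file_g]) (h6.seq (h7.seq h8))
    rw [hT2eq] at hbranch
    refine (h1.seq (h2.seq (h3.seq (h4.seq (h5.seq (hbranch.seq (hfinal _))))))).of_eq rfl ?_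
    simp only [List.length_nil, List.length_replicate]
    nlinarith [ld, lC]

/-! ### Shifts -/

/-- The arithmetic of the left shift: `2^{min b W} a ≡ a <<< b (mod 2^W)`. [folklore] -/
theorem shlW_arith (a b W : ℕ) : 2 ^ min b W * a % 2 ^ W = (a <<< b) % 2 ^ W := by
  rw [Nat.shiftLeft_eq]
  rcases le_or_gt b W with h | h
  · rw [min_eq_left h, Nat.mul_comm]
  · rw [min_eq_right h.le, Nat.mul_mod_right]
    symm
    apply Nat.mod_eq_zero_of_dvd
    exact Dvd.dvd.mul_left (Nat.pow_dvd_pow 2 h.le) a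

/-- The arithmetic of the right shift: dropping `min b |xs|` low bits divides by `2^b`.
[folklore] -/
theorem shrW_arith (xs : List Bool) (b : ℕ) :
    bitsToNat (xs.drop (min b xs.length)) = bitsToNat xs >>> b := by
  rw [Nat.shiftRight_eq_div_pow]
  have key : ∀ u, bitsToNat (xs.drop u) = bitsToNat xs / 2 ^ u := fun u => by
    have h := bitsToNat_take_add_drop xs u
    have hlt : bitsToNat (xs.take u) < 2 ^ u :=
      lt_of_lt_of_le (bitsToNat_lt _) (Nat.pow_le_pow_right Nat.two_pos (List.length_take_le u xs))
    rw [← h, Nat.add_mul_div_left _ _ (Nat.two_pow_pos u), Nat.div_eq_of_lt hlt, zero_add]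
  rcases le_or_gt b xs.length with h | h
  · rw [min_eq_left h, key]
  · rw [min_eq_right h.le, List.drop_length, bitsToNat_nil]
    symm
    apply Nat.div_eq_of_lt
    exact lt_of_lt_of_le (bitsToNat_lt xs) (Nat.pow_le_pow_right Nat.two_pos h.le)

/-- `shlW`: `x := (x <<< y) mod 2^W`, `y` emptied: `min y W` in unary (`capUnary` against a
copy of the ruler), that many zeros prepended, then truncation. [folklore] -/
def shlW : Com (κ ⊕ AReg) :=
  copy (Sum.inl r.w) (Sum.inl r.c) (Sum.inr .s) (Sum.inr .t) ;; capUnary r ;; fillFalseLoop r ;; truncNorm r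

/-- Effect of `shlW` on a canonical shift amount. [folklore] -/
theorem runs_shlW {T : Regs κ} {W : ℕ} (hT : r.Clean T W) (xs : List Bool) (b : ℕ) :
    Runs (shlW r) (Sum.elim T (file xs (encodeNat b) [] [] [] [] [] []))
      (Sum.elim T (file (encodeNat ((bitsToNat xs <<< b) % 2 ^ W)) [] [] [] [] [] [] []))
      (60 * (W + 1) ^ 2 + 80 * (W + xs.length + (encodeNat b).length) + 80) := by
  have h1 := runs_copy (a := (Sum.inl r.w : κ ⊕ AReg)) (b := Sum.inl r.c) (t := Sum.inr AReg.s)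
    (u := Sum.inr AReg.t) (by simp [r.w_c]) (by simp) (by simp) (by simp) (by simp) (by simp)
    (Sum.elim T (file xs (encodeNat b) [] [] [] [] [] [])) (by simp) (by simp)
  simp only [Sum.elim_inl, hT.hw, hT.hc, List.append_nil, Sum.update_elim_inl] at h1
  have h2 := runs_capUnary r (T := Function.update T r.c (ones W)) (C := W) (by simp)
    (by simp [r.c_c2.symm, hT.hc2]) (by simp [r.c_p.symm, hT.hp]) xs b
  rw [Function.update_idem] at h2
  set u := min b W with hu
  have h3 := runs_fillFalseLoop r (ones u) (Function.update T r.c (ones u)) xs [] [] [] [] [] [] [] (by simp)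
  rw [Function.update_idem, List.length_replicate] at h3
  have hT' : Function.update T r.c [] = T := by
    rw [← hT.hc]; exact Function.update_eq_self _ _
  rw [hT'] at h3
  have h4 := runs_truncNorm r hT (List.replicate u false ++ xs) [] [] [] []
  rw [bitsToNat_append, bitsToNat_replicate_false, zero_add, List.length_replicate, hu, shlW_arith] at h4
  refine (h1.seq (h2.seq (h3.seq h4))).of_eq rfl ?_
  have lu : min b W ≤ W := min_le_right _ _
  simp only [List.length_replicate, List.length_append]
  nlinarith [lu]

/-- `shrW`: `x := x >>> y`, `y` emptied: `min y |x|` in unary (`capUnary` against the length of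
`x`), that many low bits dropped, normalisation. [folklore] -/
def shrW : Com (κ ⊕ AReg) :=
  copy (Sum.inr AReg.x) (Sum.inl r.p) (Sum.inr .s) (Sum.inr .t) ;;
  addReg (Sum.inl r.p) (Sum.inl r.c) (Sum.inr AReg.s) ;; clear (Sum.inl r.p) ;;
  capUnary r ;; subFrom (Sum.inr AReg.x) (Sum.inl r.c) ;; bk normalize

/-- Effect of `shrW` on a canonical shift amount. [folklore] -/
theorem runs_shrW {T : Regs κ} {W : ℕ} (hT : r.Clean T W) (xs : List Bool) (b : ℕ) :
    Runs (shrW r) (Sum.elim T (file xs (encodeNat b) [] [] [] [] [] []))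
      (Sum.elim T (file (encodeNat (bitsToNat xs >>> b)) [] [] [] [] [] [] []))
      (60 * (xs.length + 1) ^ 2 + 80 * (xs.length + (encodeNat b).length) + 80) := by
  set yb := encodeNat b with hyb
  have h1 := runs_copy (a := (Sum.inr AReg.x : κ ⊕ AReg)) (b := Sum.inl r.p) (t := Sum.inr AReg.s)
    (u := Sum.inr AReg.t) (by simp) (by simp) (by simp) (by simp) (by simp) (by simp)
    (Sum.elim T (file xs yb [] [] [] [] [] [])) (by simp) (by simp)
  simp only [Sum.elim_inr, file_x, Sum.elim_inl, hT.hp, List.append_nil, Sum.update_elim_inl] at h1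
  have h2 := runs_addReg (p := (Sum.inl r.p : κ ⊕ AReg)) (v := Sum.inl r.c) (t := Sum.inr AReg.s)
    (by simp [r.c_p.symm]) (by simp) (by simp) (Sum.elim (Function.update T r.p xs) (file xs yb [] [] [] [] [] []))
    (by simp)
  simp only [Sum.elim_inl, Function.update_self, ne_eq, r.c_p, not_false_eq_true,
    Function.update_of_ne, hT.hc, List.append_nil, Sum.update_elim_inl, Function.update_idem] at h2
  have h3 := runs_clear (Sum.inl r.p : κ ⊕ AReg)
    (Sum.elim (Function.update (Function.update T r.p (ones xs.length)) r.c (ones xs.length))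
      (file xs yb [] [] [] [] [] []))
  simp only [Sum.elim_inl, ne_eq, r.c_p.symm, not_false_eq_true, Function.update_of_ne,
    Function.update_self, List.length_replicate, Sum.update_elim_inl] at h3
  set T3 := Function.update (Function.update (Function.update T r.p (ones xs.length)) r.c (ones xs.length))
    r.p [] with hT3
  have hT3eq : T3 = Function.update T r.c (ones xs.length) := by
    rw [hT3]
    funext i
    by_cases h1 : i = r.p
    · subst h1; simp [r.c_p.symm, hT.hp]
    · by_cases h2 : i = r.c
      · subst h2; simp [h1]
      · simp [h1, h2]
  rw [hT3eq] at h3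
  have h4 := runs_capUnary r (T := Function.update T r.c (ones xs.length)) (C := xs.length) (by simp)
    (by simp [r.c_c2.symm, hT.hc2]) (by simp [r.c_p.symm, hT.hp]) xs b
  rw [Function.update_idem] at h4
  set u := min b xs.length with hu
  have h5 := runs_subFrom (x := (Sum.inr AReg.x : κ ⊕ AReg)) (y := Sum.inl r.c) (by simp) (ones u)
    (Sum.elim (Function.update T r.c (ones u)) (file xs [] [] [] [] [] [] [])) (by simp)
  simp only [Sum.update_elim_inl, Function.update_idem, Sum.elim_inr, file_x, List.length_replicate,
    Sum.update_elim_inr, update_file_x] at h5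
  have hT' : Function.update T r.c [] = T := by
    rw [← hT.hc]; exact Function.update_eq_self _ _
  rw [hT'] at h5
  have h6 := (runs_normalize (xs.drop u) [] [] [] [] []).inr T
  rw [norm_eq_encodeNat, hu, shrW_arith] at h6
  refine (h1.seq (h2.seq (h3.seq (h4.seq (h5.seq h6))))).of_eq rfl ?_
  have lu : min b xs.length ≤ xs.length := min_le_right _ _
  have ld : (xs.drop (min b xs.length)).length ≤ xs.length := by simp
  nlinarith [lu, ld]

end WordArith

end Com

end Literature.Computability.Complexity
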